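import Summits.FinalStateConjecture.FinalStateConjecture.Theses.PhaseMixingCapture
import Literature.Geometry.Lorentzian.InitialDataPullback
import Literature.Geometry.Lorentzian.ConvergenceTransport
import Literature.Geometry.Lorentzian.CauchyDevelopmentIsometryClasses
import Literature.Geometry.Riemannian.AHConvexNearInfinity
import Literature.Geometry.Lorentzian.GeodesicMaximal
import Literature.Geometry.Lorentzian.LeviCivitaProofs
import Literature.Geometry.Lorentzian.IsometryProofs
import Summits.FinalStateConjecture.FinalStateConjecture.Theorems.SwallowTheDatumSubdataDevelopmentsEmbedRigidity
import HarnessLib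

/-!
# Crux `PhaseMixingCapture.WeakCosmicCensorshipMGHD` (stmt-FinalStateConjecture-9952), line
# `scri-transfer-third-of-burial`, stub `stub_scriTransfer` (THE LEVER)

**Relative far-origin completeness of `𝓘⁺` ascends along an embedding over a sub-datum.**  Let `𝒟`
be a Cauchy development of the datum `D` on `X`, `Φ : N → X` a smooth map with injective
differentials, `𝒮` any data embedding of the pulled-back datum `Φ^* D` which embeds into `𝒟`
over `Φ` by `χ` (smooth, isometric, time-orientation preserving, `χ ∘ ι' = ι ∘ Φ`), and `K ⊆ X`
compact with `Kᶜ ⊆ range Φ`.  If `𝒮` has complete future null infinity in Christodoulou's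
sojourn form RELATIVE TO COMPACT SETS OF `X` (reference set `ι'(Φ⁻¹ K₀)`, exempted origins
`Φ⁻¹ K₁`), then `𝒟` has complete future null infinity from all origins
(`Summit.FinalStateConjecture.HasCompleteNullInfinity 𝒟`).

Proof (generic Lorentzian geometry, no Kerr):

* `exists_isMaximalGeodesicOn_lift` — **maximal geodesics lift along local isometries.**  For an
  equidimensional immersion `χ : (M', g') → (M, g)` with `χ^* g = g'` (so `g'` IS the pulled-back
  metric `PseudoRiemannianMetric.comap`, by extensionality), a maximal `g`-geodesic `γ` on
  `dom ∋ 0` and initial data `(q, w)` over `(γ 0, γ' 0)`, the maximal `g'`-geodesic `γ'` with data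
  `(q, w)` (`exists_isMaximalGeodesicOn`, O'Neill 1983, Ch. 3, Prop. 3.24) has domain `dom' ⊆ dom`
  and `χ ∘ γ' = γ` on `dom'`: `χ ∘ γ'` is a `g`-geodesic
  (`Literature.Geometry.Riemannian.SimpleAH.isGeodesicOn_comp`, O'Neill 1983, pp. 90–91) with the
  initial data of `γ`, and the maximal `g`-geodesic with these data is `γ` itself on `dom`
  (uniqueness, O'Neill 1983, Ch. 3, Prop. 3.24).
* `exists_isNormalisedNullRayFrom_lift` — for data embeddings `𝒮 → 𝒟` over `Φ`, the lift of a
  normalised null ray of `𝒟` from `ι (Φ p)` is a normalised null ray of `𝒮` from `p`: null and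
  future-directed because `dχ` is a time-orientation preserving linear isometry
  (`PreservesTimeOrientation.isFutureDirected_of_mfderiv`), normalised because
  `dχ (ν' p) = ν (Φ p)` (`SubdataDevelopmentsEmbed.mfderiv_normal_rel`).
* `stub_scriTransfer` — bookkeeping `B₀ := K₀`, `B₁ := K ∪ K₁`; `¬ BddAbove dom' → ¬ BddAbove dom`;
  the sojourn of `γ'` in `J⁺_𝒮(ι'(Φ⁻¹ K₀))` is at most the sojourn of `γ` in `J⁺_𝒟(ι K₀)` because
  `χ (J⁺_𝒮(S)) ⊆ J⁺_𝒟(χ S)` (`LorentzianMetric.image_causalFuture_subset`) and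
  `χ (ι'(Φ⁻¹ K₀)) ⊆ ι K₀` (`measure_mono`).

References: B. O'Neill, *Semi-Riemannian geometry* (1983), Ch. 3, Prop. 3.24, pp. 90–91, Ch. 5,
p. 145, Ch. 14, pp. 402–403; D. Christodoulou, CQG 16 (1999) A23, pp. A26–A27;
M. Dafermos, I. Rodnianski, arXiv:0811.0354, §2.6.2.
-/

set_option linter.dupNamespace false

noncomputable section

open scoped Manifold ContDiff Topology
open Set Function Topology Literature.Geometry.Lorentzian

namespace Summit.FinalStateConjecture.FinalStateConjecture.Theorems.PhaseMixingCapture.WeakCosmicCensorshipMGHD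

/-! ## Maximal geodesics lift along local isometries -/

section Lift

variable {E : Type*} [NormedAddCommGroup E] [NormedSpace ℝ E] {H : Type*} [TopologicalSpace H]
  {I : ModelWithCorners ℝ E H} {M : Type*} [TopologicalSpace M] [ChartedSpace H M]
  [IsManifold I ∞ M]
  {E' : Type*} [NormedAddCommGroup E'] [NormedSpace ℝ E'] {H' : Type*} [TopologicalSpace H']
  {I' : ModelWithCorners ℝ E' H'} {M' : Type*} [TopologicalSpace M'] [ChartedSpace H' M']
  [IsManifold I' ∞ M']
  [FiniteDimensional ℝ E] [FiniteDimensional ℝ E'] [CompleteSpace E] [CompleteSpace E']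
  [T2Space M] [T2Space M'] [I.Boundaryless] [I'.Boundaryless]

/-- **Maximal geodesics lift along local isometries, with prescribed initial data.**  Let
`χ : M' → M` be a smooth immersion between manifolds of the same dimension with `χ^* g = g'`
(smooth metrics, Hausdorff manifolds without boundary), `γ` a maximal `g`-geodesic on `dom ∋ 0`,
and `(q, w) ∈ TM'` initial data over those of `γ`: `χ q = γ 0`, `dχ_q w = γ' 0`.  Then the
maximal `g'`-geodesic `γ'` with `γ' 0 = q`, `γ'' 0 = w` has domain `dom' ⊆ dom` and
`χ (γ' t) = γ t` for `t ∈ dom'`.  Indeed `g'` is the pulled-back metric `χ^* g`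
(`PseudoRiemannianMetric.comap`, by extensionality), so `χ ∘ γ'` is a `g`-geodesic
(`SimpleAH.isGeodesicOn_comp`) with the initial data of `γ`; the maximal `g`-geodesic with these
data restricts to `γ` on `dom` and, `γ` being maximal, has domain exactly `dom`, and it restricts
to `χ ∘ γ'` on `dom'`.  O'Neill 1983, Ch. 3, Prop. 3.24 and pp. 90–91. -/
theorem exists_isMaximalGeodesicOn_lift
    {g : PseudoRiemannianMetric I ∞ E (TangentSpace I : M → Type _)} [g.HasLeviCivita]
    {g' : PseudoRiemannianMetric I' ∞ E' (TangentSpace I' : M' → Type _)} [g'.HasLeviCivita]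
    {χ : M' → M} (hχ : ContMDiff I' I (∞ + 1) χ) (hχ' : ∀ y, Injective (mfderiv I' I χ y))
    (hdim : Module.finrank ℝ E' = Module.finrank ℝ E)
    (hiso : ∀ y, pullbackBilin (I := I) (I' := I') χ g.val y = g'.val y)
    {γ : ℝ → M} {dom : Set ℝ} (hmax : IsMaximalGeodesicOn g.leviCivita γ dom) (h0 : (0 : ℝ) ∈ dom)
    {q : M'} (hq : χ q = γ 0) {w : TangentSpace I' q}
    (hw : mfderiv I' I χ q w = velocity I γ 0) :
    ∃ (γ' : ℝ → M') (dom' : Set ℝ), IsMaximalGeodesicOn g'.leviCivita γ' dom' ∧ (0 : ℝ) ∈ dom' ∧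
      γ' 0 = q ∧ velocity I' γ' 0 = w ∧ dom' ⊆ dom ∧ ∀ t ∈ dom', χ (γ' t) = γ t := by
  have hpb := PseudoRiemannianMetric.contMDiff_pullbackBilin_holds (I := I) (M := M) (I' := I')
    (N := M') (n := (∞ : ℕ∞ω))
  -- `g'` is the pulled-back metric `χ^* g`
  have hgc : g' = g.comap hpb χ hχ hχ' hdim :=
    PseudoRiemannianMetric.ext (funext fun y ↦ (hiso y).symm)
  subst hgc
  -- the Levi-Civita connections are `C¹`
  have h2 : ((1 : ℕ∞) : ℕ∞ω) + 1 ≤ ∞ := by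
    rw [show ((1 : ℕ∞) : ℕ∞ω) + 1 = 2 by norm_num]; exact WithTop.coe_le_coe.2 le_top
  haveI : CovariantDerivative.ContMDiffCovariantDerivative g.leviCivita 1 :=
    ⟨g.isLocallyContMDiff_leviCivita_holds 1 h2 univ isOpen_univ⟩
  haveI : CovariantDerivative.ContMDiffCovariantDerivative
      (g.comap hpb χ hχ hχ' hdim).leviCivita 1 :=
    ⟨(g.comap hpb χ hχ hχ' hdim).isLocallyContMDiff_leviCivita_holds 1 h2 univ isOpen_univ⟩
  -- the maximal `χ^* g`-geodesic with data `(q, w)`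
  obtain ⟨γ', D', hmax', h0D', hγ'0, hγ'v, -⟩ :=
    exists_isMaximalGeodesicOn (cov := (g.comap hpb χ hχ hχ' hdim).leviCivita) q w
  -- its image is a `g`-geodesic with the initial data of `γ`
  obtain ⟨hcomp, hcompv⟩ := Literature.Geometry.Riemannian.SimpleAH.isGeodesicOn_comp
    (hpb := hpb) (hf := hχ) (hf' := hχ') (hdim := hdim) hmax'.isOpen hmax'.isGeodesicOn
  have hpos0 : χ (γ' 0) = γ 0 := by rw [hγ'0, hq]
  have hvel0 : velocity I (fun t ↦ χ (γ' t)) 0 = velocity I γ 0 := by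
    rw [hcompv 0 h0D']
    have h1 : (mfderiv I' I χ (γ' 0) (velocity I' γ' 0) : E) =
        mfderiv I' I χ q (velocity I' γ' 0) :=
      Literature.Geometry.Riemannian.CartanHadamard.mfderiv_congr_point hγ'0 _
    rw [h1, hγ'v, hw]
  -- the maximal `g`-geodesic with the data of `γ` is `γ` on `dom`, and contains `χ ∘ γ'`
  obtain ⟨Γ, S, hΓmax, -, -, -, hΓr⟩ :=
    exists_isMaximalGeodesicOn (cov := g.leviCivita) (γ 0) (velocity I γ 0)
  obtain ⟨hdomS, hγΓ⟩ := hΓr γ dom hmax.isOpen hmax.2.1 h0 hmax.isGeodesicOn rfl rfl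
  have hSdom : S = dom :=
    hmax.2.2.2 Γ S hΓmax.isOpen hΓmax.2.1 hdomS hΓmax.isGeodesicOn hγΓ
  obtain ⟨hD'S, hγ'Γ⟩ := hΓr (fun t ↦ χ (γ' t)) D' hmax'.isOpen hmax'.2.1 h0D' hcomp hpos0 hvel0
  rw [hSdom] at hD'S
  exact ⟨γ', D', hmax', h0D', hγ'0, hγ'v, hD'S, fun t ht ↦ (hγ'Γ ht).trans (hγΓ (hD'S ht)).symm⟩

end Lift

/-! ## Normalised null rays lift along embeddings of data embeddings over a sub-datum -/

section Data

universe u v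

variable {X : Type u} [TopologicalSpace X] [ChartedSpace E3 X] [IsManifold (𝓡 3) ∞ X]
  [ConnectedSpace X] {D : InitialDataSet (𝓡 3) X}
  {N : Type v} [TopologicalSpace N] [ChartedSpace E3 N] [IsManifold (𝓡 3) ∞ N] [ConnectedSpace N]
  {Φ : N → X} {hΦ : ContMDiff (𝓡 3) (𝓡 3) (∞ + 1) Φ}
  {hΦ' : ∀ u, Function.Injective (mfderiv (𝓡 3) (𝓡 3) Φ u)}

/-- **Normalised null rays of `𝒟` from `ι (Φ p)` lift to normalised null rays of `𝒮` from `p`.**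
Let `𝒟` be a data embedding of `D` on `X`, `𝒮` a data embedding of the pulled-back datum `Φ^* D`
on `N` (`dΦ` injective), and `χ : 𝒮 → 𝒟` a smooth, isometric, time-orientation preserving map
over `Φ` (`χ ∘ ι' = ι ∘ Φ`).  Every normalised null ray `γ : dom` of `𝒟` from `ι (Φ p)` restricts
to `χ ∘ γ'` on some `dom' ⊆ dom`, where `γ' : dom'` is a normalised null ray of `𝒮` from `p`: take
the maximal lift with data `(ι' p, dχ⁻¹ (γ' 0))` (`exists_isMaximalGeodesicOn_lift`); its velocity
is null and future-directed since `dχ` is a time-orientation preserving linear isometry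
(`PreservesTimeOrientation.isFutureDirected_of_mfderiv`), and normalised against `ν' p` because
`dχ (ν' p) = ν (Φ p)` (`SubdataDevelopmentsEmbed.mfderiv_normal_rel`).  Christodoulou, CQG 16
(1999) A23, p. A26; O'Neill 1983, Ch. 3, pp. 90–91 and Ch. 5, p. 145. -/
theorem exists_isNormalisedNullRayFrom_lift (𝒟 : DataEmbedding D)
    (𝒮 : DataEmbedding (D.comap Φ hΦ hΦ')) {χ : 𝒮.carrier → 𝒟.carrier}
    (hχ : ContMDiff (𝓡 4) (𝓡 4) ∞ χ)
    (hiso : 𝒮.metric.IsIsometricImmersion 𝒟.metric.toPseudoRiemannianMetric χ)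
    (hτ : 𝒮.timeOrientation.PreservesTimeOrientation χ 𝒟.timeOrientation)
    (hcomm : χ ∘ 𝒮.embed = 𝒟.embed ∘ Φ)
    [𝒟.metric.HasLeviCivita] [𝒮.metric.HasLeviCivita]
    {p : N} {γ : ℝ → 𝒟.carrier} {dom : Set ℝ}
    (hγ : 𝒟.metric.IsNormalisedNullRayFrom 𝒟.timeOrientation 𝒟.embed 𝒟.normal (Φ p) γ dom) :
    ∃ (γ' : ℝ → 𝒮.carrier) (dom' : Set ℝ),
      𝒮.metric.IsNormalisedNullRayFrom 𝒮.timeOrientation 𝒮.embed 𝒮.normal p γ' dom' ∧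
        dom' ⊆ dom ∧ ∀ t ∈ dom', χ (γ' t) = γ t := by
  -- `dχ` preserves scalar products, hence is injective
  have hval : ∀ (y : 𝒮.carrier) (u u' : TangentSpace (𝓡 4) y), 𝒮.metric.val y u u' =
      𝒟.metric.val (χ y) (mfderiv (𝓡 4) (𝓡 4) χ y u) (mfderiv (𝓡 4) (𝓡 4) χ y u') :=
    fun y u u' ↦ by
      have h := congrArg (fun b ↦ b u u') (hiso.2 y)
      simpa only [pullbackBilin_apply] using h.symm
  have hχ' : ∀ y, Injective (mfderiv (𝓡 4) (𝓡 4) χ y) := fun y ↦ by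
    refine (injective_iff_map_eq_zero _).2 fun u hu ↦ 𝒮.metric.nondegenerate y u fun u' ↦ ?_
    rw [hval, hu, map_zero]
    rfl
  have hdim : Module.finrank ℝ E4 = Module.finrank ℝ E4 := rfl
  have hχ1 : ContMDiff (𝓡 4) (𝓡 4) (∞ + 1) χ := hχ
  have hΦd : MDifferentiable (𝓡 3) (𝓡 3) Φ := (hΦ.of_le le_self_add).mdifferentiable (by simp)
  -- initial data of the lift
  have hx0 : χ (𝒮.embed p) = γ 0 := (congrFun hcomm p).trans hγ.apply_zero.symm
  set w : TangentSpace (𝓡 4) (𝒮.embed p) :=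
    (mfderivEquivOfInjective (I := 𝓡 4) (I' := 𝓡 4) χ (𝒮.embed p) (hχ' _) hdim).symm
      (show TangentSpace (𝓡 4) (χ (𝒮.embed p)) from velocity (𝓡 4) γ 0) with hw_def
  have hLw : mfderiv (𝓡 4) (𝓡 4) χ (𝒮.embed p) w = velocity (𝓡 4) γ 0 :=
    mfderiv_mfderivEquivOfInjective_symm χ _ (hχ' _) hdim _
  obtain ⟨γ', D', hmax', h0D', hγ'0, hγ'v, hD', hagree⟩ :=
    exists_isMaximalGeodesicOn_lift (g := 𝒟.metric.toPseudoRiemannianMetric)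
      (g' := 𝒮.metric.toPseudoRiemannianMetric) hχ1 hχ' hdim hiso.2 hγ.isMaximalGeodesicOn
      hγ.zero_mem hx0 hLw
  refine ⟨γ', D', ⟨hmax', h0D', hγ'0, ?_, ?_, ?_⟩, hD', hagree⟩
  · -- null
    have key : ∀ (y : 𝒮.carrier) (_ : y = 𝒮.embed p) (u : E4) (_ : u = w),
        𝒮.metric.IsNull (show TangentSpace (𝓡 4) y from u) := by
      rintro y rfl u rfl
      refine ⟨?_, fun hw0 ↦ hγ.isNull_velocity.2 ?_⟩
      · rw [hval, hLw]
        have key' : ∀ (x : 𝒟.carrier) (_ : x = γ 0),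
            𝒟.metric.val x (show TangentSpace (𝓡 4) x from velocity (𝓡 4) γ 0)
              (show TangentSpace (𝓡 4) x from velocity (𝓡 4) γ 0) = 0 := by
          rintro x rfl
          exact hγ.isNull_velocity.1
        exact key' _ hx0
      · rw [← hLw, hw0, map_zero]
        rfl
    exact key _ hγ'0 _ hγ'v
  · -- future-directed
    have key : ∀ (y : 𝒮.carrier) (_ : y = 𝒮.embed p) (u : E4) (_ : u = w),
        𝒮.timeOrientation.IsFutureDirected (show TangentSpace (𝓡 4) y from u) := by
      rintro y rfl u rfl
      refine hτ.isFutureDirected_of_mfderiv hiso.2 ?_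
      rw [hLw]
      have key' : ∀ (x : 𝒟.carrier) (_ : x = γ 0),
          𝒟.timeOrientation.IsFutureDirected
            (show TangentSpace (𝓡 4) x from velocity (𝓡 4) γ 0) := by
        rintro x rfl
        exact hγ.isFutureDirected_velocity
      exact key' _ hx0
    exact key _ hγ'0 _ hγ'v
  · -- normalised: `dχ (ν' p) = ν (Φ p)`
    have hν := SubdataDevelopmentsEmbed.mfderiv_normal_rel 𝒮 𝒟 hiso hτ hΦd hΦ' hcomm p
    have key : ∀ (u : E4) (_ : u = w),
        𝒮.metric.val (𝒮.embed p) (show TangentSpace (𝓡 4) (𝒮.embed p) from u) (𝒮.normal p)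
          = -1 := by
      rintro u rfl
      rw [hval, hLw, hν]
      have key' : ∀ (x : 𝒟.carrier) (_ : x = 𝒟.embed (Φ p)),
          𝒟.metric.val x (show TangentSpace (𝓡 4) x from velocity (𝓡 4) γ 0)
            (show TangentSpace (𝓡 4) x from 𝒟.normal (Φ p)) = -1 := by
        rintro x rfl
        exact hγ.val_velocity_normal
      exact key' _ (congrFun hcomm p)
    exact key _ hγ'v

end Data

/-! ## The registered stub -/

/-- **Stub `stub_scriTransfer` of the line `scri-transfer-third-of-burial` (THE LEVER; generic;
RELATIVE form).**  Let `𝒟` be a Cauchy development of `D` on `X`, `Φ : N → X` a smooth open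
embedding with injective differentials, `𝒮` ANY data embedding of `Φ^* D` which embeds into `𝒟`
OVER `Φ` (`χ` smooth, open embedding, isometric, time-orientation preserving, `χ ∘ ι' = ι ∘ Φ`),
`K ⊆ X` compact with `Kᶜ ⊆ range Φ`.  If `𝒮` has complete future null infinity RELATIVE TO
COMPACT SETS OF `X` — some compact `K₀ ⊆ X` such that for every `s > 0` some compact `K₁ ⊆ X`
such that every normalised null ray of `𝒮` from a point `p` with `Φ p ∉ K₁` is future complete or
sojourns `≥ s` in `J⁺_𝒮(ι'(Φ⁻¹ K₀))` — then `𝒟` has complete future null infinity from all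
origins.  Proof: `B₀ := K₀`, `B₁ := K ∪ K₁`; an origin `x ∉ B₁` is `Φ p` with `Φ p ∉ K₁`; a
normalised `𝒟`-ray `γ : dom` from `ι x` restricts on some `dom' ⊆ dom` to `χ ∘ γ'` with `γ'` a
normalised `𝒮`-ray from `p` (`exists_isNormalisedNullRayFrom_lift`); `¬ BddAbove dom' →
¬ BddAbove dom`, and the sojourn of `γ'` in `J⁺_𝒮(ι'(Φ⁻¹ K₀))` is at most that of `γ` in
`J⁺_𝒟(ι K₀)` since `χ (J⁺_𝒮(S)) ⊆ J⁺_𝒟(χ S)` (`LorentzianMetric.image_causalFuture_subset`) and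
`χ ∘ ι' = ι ∘ Φ`.  Christodoulou, CQG 16 (1999) A23, pp. A26–A27; Dafermos–Rodnianski,
arXiv:0811.0354, §2.6.2; O'Neill 1983, Ch. 3, pp. 90–91, Ch. 14, pp. 402–403. -/
theorem stub_scriTransfer :
  ∀ (X : Type) [TopologicalSpace X] [ChartedSpace E3 X] [IsManifold (𝓡 3) ∞ X]
    [T2Space X] [SecondCountableTopology X] [ConnectedSpace X]
    (D : InitialDataSet (𝓡 3) X) (𝒟 : CauchyDevelopment D)
    (N : Type) [TopologicalSpace N] [ChartedSpace E3 N] [IsManifold (𝓡 3) ∞ N] [ConnectedSpace N]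
    (Φ : N → X) (hΦ : ContMDiff (𝓡 3) (𝓡 3) (∞ + 1) Φ)
    (hΦ' : ∀ u, Function.Injective (mfderiv (𝓡 3) (𝓡 3) Φ u)),
    Topology.IsOpenEmbedding Φ →
    ∀ (𝒮 : DataEmbedding (D.comap Φ hΦ hΦ')) (χ : 𝒮.carrier → 𝒟.carrier),
      ContMDiff (𝓡 4) (𝓡 4) ∞ χ → Topology.IsOpenEmbedding χ →
      𝒮.metric.IsIsometricImmersion 𝒟.metric.toPseudoRiemannianMetric χ →
      𝒮.timeOrientation.PreservesTimeOrientation χ 𝒟.timeOrientation →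
      χ ∘ 𝒮.embed = 𝒟.embed ∘ Φ →
      ∀ (K : Set X), IsCompact K → Kᶜ ⊆ Set.range Φ →
      (∀ [𝒮.metric.HasLeviCivita],
        ∃ K₀ : Set X, IsCompact K₀ ∧ ∀ s : ℝ, 0 < s → ∃ K₁ : Set X, IsCompact K₁ ∧
          ∀ p : N, Φ p ∉ K₁ → ∀ (γ : ℝ → 𝒮.carrier) (dom : Set ℝ),
            𝒮.metric.IsNormalisedNullRayFrom 𝒮.timeOrientation 𝒮.embed 𝒮.normal p γ dom →
            ¬ BddAbove dom ∨ ENNReal.ofReal s ≤ sojournTime γ dom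
              (𝒮.metric.causalFuture 𝒮.timeOrientation (𝒮.embed '' (Φ ⁻¹' K₀)))) →
      Summit.FinalStateConjecture.HasCompleteNullInfinity 𝒟 := by
  intro X _ _ _ _ _ _ D 𝒟 N _ _ _ _ Φ hΦ hΦ' _hΦo 𝒮 χ hχ _hχo hiso hτ hcomm K hK hKΦ H _i𝒟
  haveI : 𝒮.metric.HasLeviCivita := 𝒮.metric.toPseudoRiemannianMetric.hasLeviCivita
  have hχd : MDifferentiable (𝓡 4) (𝓡 4) χ := hχ.mdifferentiable (by simp)
  obtain ⟨K₀, hK₀, hH⟩ := H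
  refine ⟨K₀, hK₀, fun s hs ↦ ?_⟩
  obtain ⟨K₁, hK₁, hH₁⟩ := hH s hs
  refine ⟨K ∪ K₁, hK.union hK₁, fun x hx γ dom hγ ↦ ?_⟩
  -- the origin lies in the range of `Φ`
  obtain ⟨p, rfl⟩ : x ∈ range Φ := hKΦ fun hxK ↦ hx (Or.inl hxK)
  -- lift the ray to `𝒮`
  obtain ⟨γ', dom', hγ', hdom, hagree⟩ :=
    exists_isNormalisedNullRayFrom_lift 𝒟.toDataEmbedding 𝒮 hχ hiso hτ hcomm hγ
  rcases hH₁ p (fun h ↦ hx (Or.inr h)) γ' dom' hγ' with h | h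
  · exact Or.inl fun hb ↦ h (hb.mono hdom)
  · refine Or.inr (h.trans (MeasureTheory.measure_mono fun t ht ↦ ⟨hdom ht.1, ht.2.1, ?_⟩))
    -- `χ (J⁺_𝒮(ι'(Φ⁻¹ K₀))) ⊆ J⁺_𝒟(ι K₀)`
    rw [← hagree t ht.1]
    refine LorentzianMetric.causalFuture_mono ?_
      (LorentzianMetric.image_causalFuture_subset hχd hτ hiso.2 _ (mem_image_of_mem χ ht.2.2))
    rintro _ ⟨_, ⟨q, hq, rfl⟩, rfl⟩
    exact ⟨Φ q, hq, (congrFun hcomm q).symm⟩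

end Summit.FinalStateConjecture.FinalStateConjecture.Theorems.PhaseMixingCapture.WeakCosmicCensorshipMGHD

end
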